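import Mathlib

/-!
# Solo-informed SPC4: the algebraic half of the ℤ-torus criterion (s44, claims C566u/C567)

Over `Λ = ℤ[T;T⁻¹]` with the involution `invert : T ↦ T⁻¹` and the augmentation `aug : T ↦ 1` we
certify the two elementary lemmas that turn a primitive isotropic vector of the `Λ`-intersection form
of a `ℤ`-torus exterior into the hyperbolic plane `𝓗₂` (paper/ztori-stabilisation.md, Lemma 3):

* `SoloInformed_aug_decomp` : every `x` is `C (aug x) + (1 - T) * y`.
* `SoloInformed_offdiag_unit_mul` (Lemma A) : if `x * x̄ = u * (1 - T) * (1 - T⁻¹)` with `u` a unit,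
  then `x = v * (1 - T)` with `v` a unit.
* `SoloInformed_even_hermitian` (Lemma B) : if `q̄ = q` and `aug q = 0` then
  `q = c * (1 - T) + c̄ * (1 - T⁻¹)` for some `c`.
* `SoloInformed_hyperbolic_congruence` : the resulting `2 × 2` congruence to `𝓗₂`, as a ring identity.
-/

namespace Summit.SmoothPoincare4.SmoothPoincare4.Theorems

open LaurentPolynomial AddMonoidAlgebra

/-- The augmentation `ℤ[T;T⁻¹] → ℤ`, `T ↦ 1`. -/
noncomputable def SoloInformed_aug : ℤ[T;T⁻¹] →+* ℤ := LaurentPolynomial.eval₂ (RingHom.id ℤ) 1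

/-- Evaluation at `T = -1` (used only to see that `1 - T ≠ 0`). -/
noncomputable def SoloInformed_evNeg : ℤ[T;T⁻¹] →+* ℤ := LaurentPolynomial.eval₂ (RingHom.id ℤ) (-1)

/-- Augmentation of a monomial. -/
theorem SoloInformed_aug_C_mul_T (a : ℤ) (n : ℤ) : SoloInformed_aug (C a * T n) = a := by
  simp [SoloInformed_aug]

/-- Augmentation of `T^n` is `1`. -/
theorem SoloInformed_aug_T (n : ℤ) : SoloInformed_aug (T n) = 1 := by
  simp [SoloInformed_aug]

/-- Augmentation of a constant. -/
theorem SoloInformed_aug_C (a : ℤ) : SoloInformed_aug (C a) = a := by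
  simp [SoloInformed_aug]

/-- `T ↦ -1` at `T = -1`. -/
theorem SoloInformed_evNeg_T_one : SoloInformed_evNeg (T 1) = -1 := by
  simp [SoloInformed_evNeg]

/-- `T⁻¹ ↦ -1` at `T = -1`. -/
theorem SoloInformed_evNeg_T_neg_one : SoloInformed_evNeg (T (-1)) = -1 := by
  simp [SoloInformed_evNeg]

/-- `1 - T ≠ 0` in `ℤ[T;T⁻¹]`. -/
theorem SoloInformed_one_sub_T_ne_zero : (1 - T 1 : ℤ[T;T⁻¹]) ≠ 0 := by
  intro h
  have := congrArg SoloInformed_evNeg h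
  simp [map_sub, SoloInformed_evNeg_T_one] at this

/-- `1 - T⁻¹ ≠ 0` in `ℤ[T;T⁻¹]`. -/
theorem SoloInformed_one_sub_Tinv_ne_zero : (1 - T (-1) : ℤ[T;T⁻¹]) ≠ 0 := by
  intro h
  have := congrArg SoloInformed_evNeg h
  simp [map_sub, SoloInformed_evNeg_T_neg_one] at this

/-- The augmentation is invariant under the involution `T ↦ T⁻¹`. -/
theorem SoloInformed_aug_invert (x : ℤ[T;T⁻¹]) :
    SoloInformed_aug (invert x) = SoloInformed_aug x := by
  induction x using LaurentPolynomial.induction_on' with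
  | add p q hp hq => simp [map_add, hp, hq]
  | C_mul_T n a => simp [map_mul, invert_T, SoloInformed_aug_T]

/-- `T^n - 1` is divisible by `1 - T` for every `n : ℤ`. -/
theorem SoloInformed_one_sub_T_dvd_T_sub_one (n : ℤ) :
    ∃ y : ℤ[T;T⁻¹], T n - 1 = (1 - T 1) * y := by
  induction n using Int.induction_on with
  | zero => exact ⟨0, by simp⟩
  | succ k ih =>
      obtain ⟨y, hy⟩ := ih
      refine ⟨y * T 1 - 1, ?_⟩
      have : (T ((k : ℤ) + 1) : ℤ[T;T⁻¹]) = T (k : ℤ) * T 1 := T_add _ _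
      rw [this]
      have h2 : (T (k : ℤ) : ℤ[T;T⁻¹]) * T 1 - 1 = (T (k : ℤ) - 1) * T 1 + (T 1 - 1) := by ring
      rw [h2, hy]; ring
  | pred k ih =>
      obtain ⟨y, hy⟩ := ih
      refine ⟨y * T (-1) + T (-1), ?_⟩
      have : (T (-(k : ℤ) - 1) : ℤ[T;T⁻¹]) = T (-(k : ℤ)) * T (-1) := by
        rw [← T_add]; ring_nf
      rw [this]
      have h1 : (T (-1) : ℤ[T;T⁻¹]) * T 1 = 1 := by rw [← T_add]; simp
      have h2 : (T (-(k : ℤ)) : ℤ[T;T⁻¹]) * T (-1) - 1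
          = (T (-(k : ℤ)) - 1) * T (-1) + (T (-1) - 1) := by ring
      rw [h2, hy]
      have h3 : (T (-1) : ℤ[T;T⁻¹]) - 1 = (1 - T 1) * T (-1) := by
        rw [sub_mul, one_mul, mul_comm, h1]
      rw [h3]; ring

/-- Augmentation decomposition: `x = C (aug x) + (1 - T) * y`. -/
theorem SoloInformed_aug_decomp (x : ℤ[T;T⁻¹]) :
    ∃ y : ℤ[T;T⁻¹], x = C (SoloInformed_aug x) + (1 - T 1) * y := by
  induction x using LaurentPolynomial.induction_on' with
  | add p q hp hq =>
      obtain ⟨y₁, h₁⟩ := hp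
      obtain ⟨y₂, h₂⟩ := hq
      refine ⟨y₁ + y₂, ?_⟩
      conv_lhs => rw [h₁, h₂]
      simp only [map_add]
      ring
  | C_mul_T n a =>
      obtain ⟨y, hy⟩ := SoloInformed_one_sub_T_dvd_T_sub_one n
      refine ⟨C a * y, ?_⟩
      rw [SoloInformed_aug_C_mul_T]
      have : C a * T n = C a + C a * (T n - 1) := by ring
      rw [this, hy]; ring

/-- The augmentation ideal is `(1 - T)`. -/
theorem SoloInformed_dvd_of_aug_eq_zero {x : ℤ[T;T⁻¹]} (hx : SoloInformed_aug x = 0) :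
    ∃ y : ℤ[T;T⁻¹], x = (1 - T 1) * y := by
  obtain ⟨y, hy⟩ := SoloInformed_aug_decomp x
  exact ⟨y, by simpa [hx] using hy⟩

/-- **Lemma A.** If `x * x̄ = u * (1 - T) * (1 - T⁻¹)` with `u` a unit of `ℤ[T;T⁻¹]`, then
`x = v * (1 - T)` for a unit `v`.  (The off-diagonal entry of the intersection matrix in a basis
containing a primitive isotropic vector is a unit multiple of `1 - T`.) -/
theorem SoloInformed_offdiag_unit_mul (x u : ℤ[T;T⁻¹]) (hu : IsUnit u)
    (h : x * invert x = u * ((1 - T 1) * (1 - T (-1)))) :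
    ∃ v : ℤ[T;T⁻¹], IsUnit v ∧ x = v * (1 - T 1) := by
  -- augment: (aug x)^2 = 0
  have haug : SoloInformed_aug x = 0 := by
    have := congrArg SoloInformed_aug h
    simp only [map_mul, SoloInformed_aug_invert, map_sub, map_one, SoloInformed_aug_T,
      sub_self, mul_zero] at this
    exact mul_self_eq_zero.mp this
  obtain ⟨y, hy⟩ := SoloInformed_dvd_of_aug_eq_zero haug
  have hinv : invert x = (1 - T (-1)) * invert y := by
    rw [hy, map_mul, map_sub, map_one, invert_T]
  -- cancel (1 - T)(1 - T⁻¹)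
  have key : ((1 - T 1) * (1 - T (-1))) * (y * invert y) = ((1 - T 1) * (1 - T (-1))) * u := by
    have := h
    rw [hinv, hy] at this
    calc ((1 - T 1) * (1 - T (-1))) * (y * invert y)
        = (1 - T 1) * y * ((1 - T (-1)) * invert y) := by ring
      _ = u * ((1 - T 1) * (1 - T (-1))) := this
      _ = ((1 - T 1) * (1 - T (-1))) * u := by ring
  have hne : ((1 - T 1) * (1 - T (-1)) : ℤ[T;T⁻¹]) ≠ 0 :=
    mul_ne_zero SoloInformed_one_sub_T_ne_zero SoloInformed_one_sub_Tinv_ne_zero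
  have hyu : y * invert y = u := mul_left_cancel₀ hne key
  have hyunit : IsUnit y := by
    have : IsUnit (y * invert y) := by rw [hyu]; exact hu
    exact isUnit_of_mul_isUnit_left this
  exact ⟨y, hyunit, by rw [hy]; ring⟩


/-! ### Lemma B: even Hermitian elements -/

/-- Coefficients of `T m * f`. -/
theorem SoloInformed_coeff_T_mul (m n : ℤ) (f : ℤ[T;T⁻¹]) :
    (T m * f).coeff n = f.coeff (-m + n) := by
  show (AddMonoidAlgebra.single m (1 : ℤ) * f).coeff n = _
  rw [AddMonoidAlgebra.coeff_single_mul_apply, one_mul]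

/-- `T * T⁻¹ = 1`. -/
theorem SoloInformed_T_one_mul_T_neg_one : (T 1 : ℤ[T;T⁻¹]) * T (-1) = 1 := by
  rw [← T_add]; simp

/-- The non-negative part `Σ_{n ≥ 0} aₙ Tⁿ` of a Laurent polynomial `Σ aₙ Tⁿ`. -/
noncomputable def SoloInformed_posPart (y : ℤ[T;T⁻¹]) : ℤ[T;T⁻¹] :=
  AddMonoidAlgebra.ofCoeff (y.coeff.filter fun n : ℤ => 0 ≤ n)

/-- Coefficients of the non-negative part. -/
theorem SoloInformed_coeff_posPart (y : ℤ[T;T⁻¹]) (n : ℤ) :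
    (SoloInformed_posPart y).coeff n = if 0 ≤ n then y.coeff n else 0 := by
  simp [SoloInformed_posPart, Finsupp.filter_apply]

/-- If `y = -T⁻¹ ȳ` (coefficientwise `aₙ = -a₋₁₋ₙ`) then `y = c - T⁻¹ c̄` with `c` the
non-negative part of `y`. -/
theorem SoloInformed_twisted_antisymm_split (y : ℤ[T;T⁻¹])
    (hy : y = -(T (-1) * invert y)) :
    y = SoloInformed_posPart y - T (-1) * invert (SoloInformed_posPart y) := by
  have hcoeff : ∀ n : ℤ, y.coeff n = -(y.coeff (-1 - n)) := by
    intro n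
    have h : y.coeff n = (-(T (-1) * invert y)).coeff n :=
      congrArg (fun z : ℤ[T;T⁻¹] => z.coeff n) hy
    rw [AddMonoidAlgebra.coeff_neg] at h
    simp only [Finsupp.coe_neg, Pi.neg_apply, SoloInformed_coeff_T_mul, invert_apply] at h
    rw [h]; congr 2; ring
  apply LaurentPolynomial.ext
  intro n
  rw [AddMonoidAlgebra.coeff_sub]
  simp only [Finsupp.coe_sub, Pi.sub_apply, SoloInformed_coeff_T_mul, invert_apply,
    SoloInformed_coeff_posPart]
  by_cases hn : 0 ≤ n
  · have h2 : ¬ (0 ≤ -(-(-1 : ℤ) + n)) := by omega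
    rw [if_pos hn, if_neg h2]; ring
  · have h2 : (0 ≤ -(-(-1 : ℤ) + n)) := by omega
    rw [if_neg hn, if_pos h2, hcoeff n]
    have : -(-(-1 : ℤ) + n) = -1 - n := by ring
    rw [this]; ring

/-- **Lemma B.** A Hermitian element of augmentation zero is of the form `c (1 - T) + c̄ (1 - T⁻¹)`.
(The diagonal entry of the intersection matrix of a `ℤ`-torus exterior is of this form, because the
ordinary intersection form of the exterior vanishes; with Lemma A this is exactly the hypothesis of
Juhász–Powell, Lemma 2.4.) -/
theorem SoloInformed_even_hermitian (q : ℤ[T;T⁻¹]) (hh : invert q = q)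
    (h0 : SoloInformed_aug q = 0) :
    ∃ c : ℤ[T;T⁻¹], q = c * (1 - T 1) + invert c * (1 - T (-1)) := by
  obtain ⟨y, hy⟩ := SoloInformed_dvd_of_aug_eq_zero h0
  -- Hermitian symmetry forces `y = -T⁻¹ ȳ`
  have hanti : y = -(T (-1) * invert y) := by
    have h1 : invert q = (1 - T (-1)) * invert y := by
      rw [hy, map_mul, map_sub, map_one, invert_T]
    have h2 : (1 - T (-1) : ℤ[T;T⁻¹]) = -(T (-1)) * (1 - T 1) := by
      have := SoloInformed_T_one_mul_T_neg_one
      linear_combination (-1 : ℤ[T;T⁻¹]) * this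
    have h3 : (1 - T 1) * y = (1 - T 1) * (-(T (-1) * invert y)) := by
      calc (1 - T 1) * y = q := hy.symm
        _ = invert q := hh.symm
        _ = (1 - T (-1)) * invert y := h1
        _ = (1 - T 1) * (-(T (-1) * invert y)) := by rw [h2]; ring
    exact mul_left_cancel₀ SoloInformed_one_sub_T_ne_zero h3
  refine ⟨SoloInformed_posPart y, ?_⟩
  have hsplit := SoloInformed_twisted_antisymm_split y hanti
  have hTT := SoloInformed_T_one_mul_T_neg_one
  rw [hy]
  conv_lhs => rw [hsplit]
  linear_combination (invert (SoloInformed_posPart y)) * hTT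

/-! ### The congruence to the hyperbolic plane -/

/-- **Lemma 3 (algebraic form).** Let `G = [[0, x], [x̄, q]]` be the Gram matrix of a Hermitian
form (`λ(αa, βb) = α β̄ λ(a,b)`) in a basis `(e, f)` with `e` isotropic, and suppose
`x x̄ = u (1 - T)(1 - T⁻¹)` with `u` a unit, `q̄ = q`, `aug q = 0`.  Then there are `α` a unit and
`γ` such that the basis `(e, α f - γ e)` has Gram matrix `𝓗₂ = [[0, 1 - T], [1 - T⁻¹, 0]]`:
the four entries are certified as ring identities. -/
theorem SoloInformed_hyperbolic_plane_criterion (x q u : ℤ[T;T⁻¹]) (hu : IsUnit u)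
    (hdet : x * invert x = u * ((1 - T 1) * (1 - T (-1))))
    (hh : invert q = q) (h0 : SoloInformed_aug q = 0) :
    ∃ α γ : ℤ[T;T⁻¹], IsUnit α ∧
      -- λ(e, e) = 0 is the hypothesis (isotropy); λ(e, αf - γe) = ᾱ x - γ̄ 0 :
      invert α * x = 1 - T 1 ∧
      -- λ(αf - γe, e) = α x̄ :
      α * invert x = 1 - T (-1) ∧
      -- λ(αf - γe, αf - γe) = α ᾱ q - α γ̄ x̄ - γ ᾱ x :
      α * invert α * q - α * invert γ * invert x - γ * invert α * x = 0 := by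
  obtain ⟨v, hv, hx⟩ := SoloInformed_offdiag_unit_mul x u hu hdet
  obtain ⟨c, hc⟩ := SoloInformed_even_hermitian q hh h0
  obtain ⟨w, hw⟩ := hv.exists_left_inv
  have hwu : IsUnit w := IsUnit.of_mul_eq_one v hw
  have hwbar : invert w * invert v = 1 := by rw [← map_mul, hw, map_one]
  have hinv2 : invert (invert w) = w := involutive_invert w
  -- α := conj(v⁻¹) = invert w, γ := α ᾱ c
  refine ⟨invert w, invert w * w * c, hwu.map invert, ?_, ?_, ?_⟩
  · rw [hinv2, hx, ← mul_assoc, hw, one_mul]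
  · rw [hx, map_mul, map_sub, map_one, invert_T, ← mul_assoc, hwbar, one_mul]
  · have e1 : invert (invert w * w * c) = w * invert w * invert c := by
      rw [map_mul, map_mul, hinv2]
    have e2 : invert x = invert v * (1 - T (-1)) := by
      rw [hx, map_mul, map_sub, map_one, invert_T]
    rw [e1, e2, hinv2, hc, hx]
    linear_combination (-(invert w * w * c * (1 - T 1))) * hw
      + (-(invert w * w * invert c * (1 - T (-1)))) * hwbar

end Summit.SmoothPoincare4.SmoothPoincare4.Theorems
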